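import Mathlib

/-!
# Tier3RieszComponent — the `τ`-component of the expansion (b1) and its Riesz vector
(T3.5 for T3.1; PERIOD.md §4.3 (b1), (b5) and (c))

PERIOD.md §4.3 (b1): «expanding the kernel … along an orthonormal basis `{f}` of each `τ`,
`θ₀ ∧ θ₁ = Σ_τ Σ_f P_T(χ₀⊗χ₁; f) · θ(f̄, ϕ)` with `P_T(χ; f) := ∫_{[T]} χ(t) f(t) dt` — the `τ`-component is
`θ(F̄_τ, ϕ)`, `F_τ ∈ τ` the Riesz vector of the `T`-period functional on `τ` (`F_τ ≠ 0 ⟺ P_T(χ₀⊗χ₁; ·) ≢ 0 on τ`)»;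
(b5) «`u_τ ≠ 0 ⟺ F_τ ≠ 0 ∧ θ(F̄_τ, ϕ) ≠ 0`»; (c) «`F_τ ≠ 0` … are exactly TP1 Thm 1.4» (TP1 speaks of
`P_T(χ; f) ≠ 0` for some `f ∈ τ`).  This file is the finite-dimensional linear algebra of those three sentences
on a finite-dimensional complex inner product space `τ` (the `K`-fixed vectors of one `τ` at level `K`):
the period functional is a continuous linear `ℓ : τ →L[ℂ] ℂ`, its Riesz vector is
`F_ℓ := (InnerProductSpace.toDual ℂ τ).symm ℓ` (so `⟪F_ℓ, v⟫ = ℓ v`), the lift `f ↦ θ(f̄, ϕ)` is a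
CONJUGATE-linear map `Λ : τ →ₗ⋆[ℂ] P`.
* `riesz_eq_sum`: `F_ℓ = Σ_i conj (ℓ (b i)) • b i` for any orthonormal basis `b` (the coordinates of the Riesz
  vector are the conjugated values of the functional);
* **`component_eq_apply_riesz`**: `Σ_i ℓ (b i) • Λ (b i) = Λ F_ℓ` — the `τ`-component of (b1) IS `θ(F̄_τ, ϕ)`;
* **`riesz_ne_zero_iff`** / `exists_apply_ne_zero_iff_riesz_ne_zero`: `F_ℓ ≠ 0 ⟺ ℓ ≠ 0 ⟺ ∃ f, ℓ f ≠ 0` — the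
  bridge between (b1)'s `F_τ ≠ 0` and TP1's «`P_T(χ; f) ≠ 0` for some `f ∈ τ`» used in (c);
* `component_ne_zero_iff` / `riesz_ne_zero_of_component_ne_zero`: the component is non-zero iff `Λ F_ℓ ≠ 0`,
  which forces `F_ℓ ≠ 0` — (b5)'s «`u_τ ≠ 0 ⟺ F_τ ≠ 0 ∧ θ(F̄_τ, ϕ) ≠ 0`».
What stays on the page: the `L²`-expansion of the kernel over the Hilbert direct sum of the `τ` (analysis;
finitely many `τ` with `τ^K ≠ 0` contribute at level `K`) and the conjugate-linearity of `f ↦ θ(f̄, ϕ)` (its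
definition).  No definition, no notation, `import Mathlib` only.
Nothing here asserts anything about the original programme; HC_CM is NOT proved by anyone in this repository.
-/

namespace HodgeRepro.T3P1.RieszComponent

open InnerProductSpace ComplexConjugate

variable {τ : Type*} [NormedAddCommGroup τ] [InnerProductSpace ℂ τ] [CompleteSpace τ]
variable {P : Type*} [AddCommGroup P] [Module ℂ P]

/-- The Riesz vector `F_ℓ = (toDual ℂ τ).symm ℓ` represents `ℓ`: `⟪F_ℓ, v⟫ = ℓ v`. -/
theorem inner_riesz (ℓ : τ →L[ℂ] ℂ) (v : τ) : ⟪(toDual ℂ τ).symm ℓ, v⟫_ℂ = ℓ v :=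
  toDual_symm_apply

/-- The Riesz vector is non-zero iff the functional is. -/
theorem riesz_ne_zero_iff (ℓ : τ →L[ℂ] ℂ) : (toDual ℂ τ).symm ℓ ≠ 0 ↔ ℓ ≠ 0 := by
  constructor
  · intro h hℓ
    apply h
    rw [hℓ, map_zero]
  · intro h h0
    apply h
    have := congrArg (toDual ℂ τ) h0
    rwa [LinearIsometryEquiv.apply_symm_apply, map_zero] at this

/-- **The bridge to TP1.** `F_ℓ ≠ 0 ⟺ ∃ f, ℓ f ≠ 0`: the period functional is non-zero on `τ` iff its
Riesz vector is — (b1)'s `F_τ ≠ 0 ⟺ P_T(χ; ·) ≢ 0 on τ`, which (c) matches with TP1's «for some `f ∈ τ`». -/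
theorem exists_apply_ne_zero_iff_riesz_ne_zero (ℓ : τ →L[ℂ] ℂ) :
    (∃ f : τ, ℓ f ≠ 0) ↔ (toDual ℂ τ).symm ℓ ≠ 0 := by
  rw [riesz_ne_zero_iff]
  constructor
  · rintro ⟨f, hf⟩ h0
    apply hf
    rw [h0]
    rfl
  · intro h
    by_contra hcon
    push Not at hcon
    apply h
    ext f
    exact hcon f

/-- The coordinates of the Riesz vector in an orthonormal basis are the conjugated values of the
functional: `F_ℓ = Σ_i conj (ℓ (b i)) • b i`. -/
theorem riesz_eq_sum {ι : Type*} [Fintype ι] (b : OrthonormalBasis ι ℂ τ) (ℓ : τ →L[ℂ] ℂ) :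
    (toDual ℂ τ).symm ℓ = ∑ i, conj (ℓ (b i)) • b i := by
  apply ext_inner_right ℂ
  intro v
  rw [inner_riesz, sum_inner]
  simp only [inner_smul_left, starRingEnd_self_apply]
  -- `ℓ v = Σ_i ℓ (b i) * ⟪b i, v⟫`: expand `v` in the basis
  conv_lhs => rw [← b.sum_repr' v]
  rw [map_sum]
  refine Finset.sum_congr rfl fun i _ => ?_
  rw [map_smul, smul_eq_mul, mul_comm]

/-- **The `τ`-component of (b1).** For a conjugate-linear lift `Λ` (the map `f ↦ θ(f̄, ϕ)`),
`Σ_i ℓ (b i) • Λ (b i) = Λ F_ℓ`: the component is the lift of the Riesz vector. -/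
theorem component_eq_apply_riesz {ι : Type*} [Fintype ι] (b : OrthonormalBasis ι ℂ τ)
    (ℓ : τ →L[ℂ] ℂ) (Λ : τ →ₗ⋆[ℂ] P) :
    ∑ i, ℓ (b i) • Λ (b i) = Λ ((toDual ℂ τ).symm ℓ) := by
  rw [riesz_eq_sum b ℓ, map_sum]
  refine Finset.sum_congr rfl fun i _ => ?_
  rw [LinearMap.map_smulₛₗ, starRingEnd_self_apply]

/-- The component is non-zero iff the lift of the Riesz vector is. -/
theorem component_ne_zero_iff {ι : Type*} [Fintype ι] (b : OrthonormalBasis ι ℂ τ)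
    (ℓ : τ →L[ℂ] ℂ) (Λ : τ →ₗ⋆[ℂ] P) :
    (∑ i, ℓ (b i) • Λ (b i)) ≠ 0 ↔ Λ ((toDual ℂ τ).symm ℓ) ≠ 0 := by
  rw [component_eq_apply_riesz]

/-- (b5): a non-zero component forces `F_ℓ ≠ 0` (and hence `ℓ ≢ 0` on `τ`). -/
theorem riesz_ne_zero_of_component_ne_zero {ι : Type*} [Fintype ι] (b : OrthonormalBasis ι ℂ τ)
    (ℓ : τ →L[ℂ] ℂ) (Λ : τ →ₗ⋆[ℂ] P) (h : (∑ i, ℓ (b i) • Λ (b i)) ≠ 0) :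
    (toDual ℂ τ).symm ℓ ≠ 0 ∧ ∃ f : τ, ℓ f ≠ 0 := by
  rw [component_eq_apply_riesz] at h
  have hF : (toDual ℂ τ).symm ℓ ≠ 0 := by
    intro h0
    apply h
    rw [h0, map_zero]
  exact ⟨hF, (exists_apply_ne_zero_iff_riesz_ne_zero ℓ).mpr hF⟩

end HodgeRepro.T3P1.RieszComponent
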